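import Summits.ResolutionOfSingularities.ResolutionOfSingularities.Theorems.PurelyInseparableDim4JointForestRootNormalised
import Summits.ResolutionOfSingularities.ResolutionOfSingularities.Theorems.PurelyInseparableDim4JointTwoChartComputations
import HarnessLib

/-!
# Purely inseparable four-folds: an instance of the monotone joint forest whose CHILD IS VISIBLE IN TWO CHARTS —
# `z^p + x₁^{2p} x₃ + (x₂ − x₁)^p x₄` is order-reduced by blowing up the surface `V(z, x₁, x₂)` and then the surface
# child `{x₂/x₁ = 1}` of the exceptional divisor, for every prime `p` (brick S3 (c) «joint point∘coordinate chains»,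
# part 22, cell `res-dim4-pi`)

[OURS · counted 0] (D-0157 DOOR 2; desk WORD #66 (4)(c), #74 (g), #99 (d); frame `PIDim4.TerminationImpliesOrderReduction`,
S3 (c); host item stmt-ResolutionOfSingularities-16155, helper). Nothing here proves resolution of singularities in
dimension ≥ 4 / characteristic `p` — NOT here, not anywhere in this programme.

`F = x₁^{2p} x₃ + (x₂ − x₁)^p x₄`, `K = K̄` of characteristic `p`, any prime `p`. Linear coefficients of `F(x + b)` are
values of partial derivatives (`coeff_single_one_translate`): `∂F/∂x₃ = x₁^{2p}`, `∂F/∂x₄ = (x₂ − x₁)^p`, so the closed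
order-`p` points of `z^p + F` form the surface `{x₁ = x₂ = 0}` (`roots_inst₄`): ONE initial member `(0, {x₁, x₂})`. In the
`x₁`-chart the transform is `z′^p + y₁^p y₃ + (y₂^p − 1) y₄` (`chartTransform_inst₄_zero`), equimultiple exactly where
`y₂ = 1` (`eq_one_of_isEquimultiplePoint_inst₄`): the CHILD is the surface `{y₁ = 0, y₂ = 1}` — the section `x₂/x₁ = 1` of the
exceptional `ℙ²`-bundle — which is ALSO visible in the `x₂`-chart (there `z′^p + y₁^{2p} y₂^p y₃ + (1 − y₁^p) y₄`,
`chartTransform_inst₄_one`, equimultiple where `y₁ = 1`). Part 14's per-chart COVER would demand a second entry for the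
same child in the `x₂`-chart (forbidden by separation); the NORMALISED cover of parts 19–21 asks nothing of the `x₂`-chart
representatives (`y₁ = 1 ≠ 0` is not normalised), and the normalised `x₂`-chart pairs (`y₁ = 0`) are not equimultiple
(`not_isEquimultiplePoint_inst₄_one`). The child's equation is part 5's `x₁^p x₃ + x₂^p x₄`, with no equimultiple point
over it. Hence, by part 21:

* **`exists_isMarkedResolution_inst₄`** — `(𝔸⁵_K, (z^p + x₁^{2p} x₃ + (x₂ − x₁)^p x₄)·𝒪, [], p)` admits a marked resolution
  (BGMW Def. 3.1.3). UNCONDITIONAL; the first kernel instance needing the chart transposition of part 17.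

AI-produced formalisation, weaker than expert review. bears_on: LADDER-RESOLUTION:D157-DOOR2 (res-dim4-pi · S3 (c) joint v2 ·
two-chart instance).
-/

set_option linter.dupNamespace false -- D-0017: single-problem summit path `Summit.<S>.<S>.…` by design

noncomputable section

open MvPolynomial Finset CategoryTheory AlgebraicGeometry Opposite TopologicalSpace

namespace Summit.ResolutionOfSingularities.ResolutionOfSingularities.Theorems.PIDim4

open Literature.AlgebraicGeometry.Resolution
open Literature.AlgebraicGeometry.Resolution.Hauser2010
open Literature.AlgebraicGeometry.Resolution.AffinePointBlowup (P A γ coord Wtop ξ)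

namespace Equimultiple

section Instance₄

variable {K : Type} [Field K] {p : ℕ} [hp : Fact p.Prime] [CharP K p]

/-! ## §3 The certificate -/

/-- **`z^p + x₁^{2p} x₃ + (x₂ − x₁)^p x₄` ADMITS A MARKED RESOLUTION BY TWO SURFACE BLOW-UPS** (`K = K̄` of
characteristic `p`, every prime `p`): the monotone joint forest (normalised cover) at the root with the one initial member
`(0, {x₁, x₂})`, the plan `(F, {x₁,x₂}) ↦ {(x₁, (0,1,0,0), {x₁,x₂})}`, `∅` after, no leaf, no point member; the child
`{y₁ = 0, y₂ = 1}` is visible in both charts and is listed ONCE. [cite: BierstoneGrigorievMilmanWlodarczyk2011, Def. 3.1.3]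
[cite: HauserPerlega2019PRIMS, §2] [cite: Hauser2010, §F] -/
theorem exists_isMarkedResolution_inst₄ [IsAlgClosed K] [DecidableEq K] :
    ∃ (X' : Scheme.{0}) (ρ : X' ⟶ P 4 K) (M' : MarkedIdeal X'),
      IsMarkedResolution (⟨hypSheaf p (X 0 ^ (2 * p) * X 2 + (X 1 - X 0) ^ p * X 3 : MvPolynomial (Fin 4) K), [], p⟩ :
        MarkedIdeal (P 4 K)) ρ M' := by
  classical
  set F₀ : MvPolynomial (Fin 4) K := X 0 ^ (2 * p) * X 2 + (X 1 - X 0) ^ p * X 3 with hF₀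
  set e₁ : Fin 4 → K := Function.update (0 : Fin 4 → K) 1 1 with he₁
  have he₁0 : e₁ 0 = 0 := by rw [he₁, Function.update_of_ne (show (0 : Fin 4) ≠ 1 by decide), Pi.zero_apply]
  have he₁1 : e₁ 1 = 1 := by rw [he₁, Function.update_self]
  have hG₀ : deletePthPowers p (PointBlowup.translate (0 : Fin 4 → K) F₀) = F₀ := by
    rw [PointBlowup.translate_zero]
    exact Literature.Barriers.ResolutionOfSingularities.HauserPerlega.deletePthPowers_eq_self isClean_inst₄
  set s₀ : State K := ⟨F₀, 0, ∅⟩ with hs₀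
  set s₁ : State K := CentreBlowup.step p ({0, 1} : Finset (Fin 4)) 0 e₁ s₀ with hs₁
  have hs₁F : s₁.F = X 0 ^ p * X 2 + X 1 ^ p * X 3 := step_F_inst₄
  have hs₁ne : ¬ (s₁.F = F₀ ∧ ({0, 1} : Finset (Fin 4)) = {0, 1}) := fun h => inst_ne_inst₄ (hs₁F.symm.trans h.1)
  -- the rules: one planned surface child, listed in the `x₁`-chart only; nothing over the child; no leaves
  let plan : State K → Finset (Fin 4) → Finset (Fin 4 × (Fin 4 → K) × Finset (Fin 4)) := fun s S =>
    if s.F = F₀ ∧ S = ({0, 1} : Finset (Fin 4)) then {((0 : Fin 4), e₁, ({0, 1} : Finset (Fin 4)))} else ∅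
  let leaves : State K → Finset (Fin 4) → Finset (Fin 4 × (Fin 4 → K)) := fun _ _ => ∅
  have hplan₀ : plan s₀ {0, 1} = {((0 : Fin 4), e₁, ({0, 1} : Finset (Fin 4)))} := if_pos ⟨rfl, rfl⟩
  have hplan₁ : plan s₁ {0, 1} = ∅ := if_neg hs₁ne
  have hleaves₀ : leaves s₀ {0, 1} = ∅ := rfl
  have hleaves₁ : leaves s₁ {0, 1} = ∅ := rfl
  -- the states reachable along the plan
  have hreach : ∀ q : State K × Finset (Fin 4),
      Relation.ReflTransGen (fun q q' : State K × Finset (Fin 4) =>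
        ∃ e ∈ plan q.1 q.2, q' = (CentreBlowup.step p q.2 e.1 e.2.1 q.1, e.2.2)) (s₀, {0, 1}) q →
      q = (s₀, {0, 1}) ∨ q = (s₁, {0, 1}) := by
    intro q hq
    induction hq with
    | refl => exact Or.inl rfl
    | tail _ hR ih =>
      obtain ⟨e, he, rfl⟩ := hR
      rcases ih with h | h <;> rw [h] at he ⊢
      · rw [hplan₀, Finset.mem_singleton] at he
        subst he
        exact Or.inr rfl
      · rw [hplan₁] at he
        exact absurd he (Finset.notMem_empty e)
  have hacc₁ : Acc (fun q' q : State K × Finset (Fin 4) =>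
      ∃ e ∈ plan q.1 q.2, q' = (CentreBlowup.step p q.2 e.1 e.2.1 q.1, e.2.2)) (s₁, {0, 1}) :=
    Acc.intro _ fun q' ⟨e, he, _⟩ => by
      rw [hplan₁] at he
      exact absurd he (Finset.notMem_empty e)
  have hacc₀ : Acc (fun q' q : State K × Finset (Fin 4) =>
      ∃ e ∈ plan q.1 q.2, q' = (CentreBlowup.step p q.2 e.1 e.2.1 q.1, e.2.2)) (s₀, {0, 1}) :=
    Acc.intro _ fun q' ⟨e, he, hq'⟩ => by
      rw [hplan₀, Finset.mem_singleton] at he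
      subst he
      rw [hq']
      exact hacc₁
  refine exists_isMarkedResolution_joint_forest_root_normalised F₀ inst₄_ne_zero isClean_inst₄ plan leaves
    {((0 : Fin 4 → K), ({0, 1} : Finset (Fin 4)))} (fun bS hbS => ?_) (fun bS hbS bS' hbS' hne => ?_)
    (Set.finite_empty.subset ?_) (fun b' H hoff => ?_)
  · -- the member `(0, {x₁, x₂})`: permissible, hereditary plan conditions, `Acc`
    rw [Finset.mem_singleton] at hbS
    subst hbS
    dsimp only
    rw [hG₀]
    refine ⟨isPermissibleCentre_inst₄, fun q hq => ?_, hacc₀⟩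
    rcases hreach q hq with rfl | rfl <;> dsimp only
    · -- over the surface: the child, in the `x₁`-chart only
      rw [hplan₀, hleaves₀]
      refine ⟨fun e he => ?_, fun e he e' he' hne => ?_, fun l hl => absurd hl (Finset.notMem_empty l),
        fun j' b' hj' hb' hnorm heq => ?_⟩
      · rw [Finset.mem_singleton] at he
        subst he
        dsimp only
        refine ⟨Finset.mem_insert_self _ _, he₁0, Finset.Subset.refl _, isEquimultiplePoint_inst₄_entry, ?_⟩
        rw [step_F_inst₄]
        exact isPermissibleCentre_inst
      · rw [Finset.mem_singleton] at he he'
        exact absurd (he.trans he'.symm) hne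
      · rcases Finset.mem_insert.mp hj' with rfl | hj'
        · -- `x₁`-chart: agrees with the entry
          refine Or.inl ⟨((0 : Fin 4), e₁, ({0, 1} : Finset (Fin 4))), Finset.mem_singleton_self _, rfl, fun i hi => ?_⟩
          dsimp only
          rcases Finset.mem_insert.mp hi with rfl | hi
          · rw [he₁0]; exact hb'
          · rw [Finset.mem_singleton] at hi
            subst hi
            rw [he₁1]
            exact eq_one_of_isEquimultiplePoint_inst₄ heq
        · -- `x₂`-chart: a normalised pair is not equimultiple
          rw [Finset.mem_singleton] at hj'
          subst hj'
          exact absurd heq (not_isEquimultiplePoint_inst₄_one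
            (hnorm 0 (Finset.mem_insert_self _ _) (by decide)))
    · -- over the child: nothing is equimultiple
      rw [hplan₁, hleaves₁]
      refine ⟨fun e he => absurd he (Finset.notMem_empty e), fun e he => absurd he (Finset.notMem_empty e),
        fun l hl => absurd hl (Finset.notMem_empty l), fun j' b' hj' _ _ heq => ?_⟩
      exfalso
      refine not_isEquimultiplePoint_inst hj' b' ?_
      unfold CentreBlowup.IsEquimultiplePoint CentreBlowup.pointTransform at heq ⊢
      rw [hs₁F] at heq
      exact heq
  · -- one member only
    rw [Finset.mem_singleton] at hbS hbS'
    exact absurd (hbS.trans hbS'.symm) hne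
  · -- no root parameter off the member
    rintro b' ⟨H, hoff⟩
    obtain ⟨h0, h1⟩ := roots_inst₄ b' H
    exact hoff ((0 : Fin 4 → K), {0, 1}) (Finset.mem_singleton_self _) (fun i hi => by
      rcases Finset.mem_insert.mp hi with rfl | hi
      · exact h0
      · rw [Finset.mem_singleton] at hi; subst hi; exact h1)
  · exfalso
    obtain ⟨h0, h1⟩ := roots_inst₄ b' H
    exact hoff ((0 : Fin 4 → K), {0, 1}) (Finset.mem_singleton_self _) (fun i hi => by
      rcases Finset.mem_insert.mp hi with rfl | hi
      · exact h0
      · rw [Finset.mem_singleton] at hi; subst hi; exact h1)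

end Instance₄

end Equimultiple

end Summit.ResolutionOfSingularities.ResolutionOfSingularities.Theorems.PIDim4

end
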